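import Summits.QuantumFields.BalabanUV.Beta.FP.SliceChainN
import Summits.QuantumFields.BalabanUV.Beta.FP.PuncturedCoordDeriv

/-!
# `BalabanUV.Beta.FP.LatticeKernelShiftChain` — road «FP» for binder row D1, leaf H2-P of the horizontal route, row H2-P-KER-ASM v1.1 (R-FP-21 (B3):
# «v1.1 = (K2),(K3) at the exponents of record 4∕5 after the order-5 chain»), PART V1 [folklore, generic]: LATTICE DIFFERENCES AS LATTICE KERNELS OF
# CHARACTER-WEIGHTED SYMBOLS, the slice chain of the character factor `χ_μ(P) = e^{iP_μ} − 1` in every coordinate, the Leibniz product family with an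
# arbitrary member family, and the INTEGER-GRADED Leibniz letters (a factor vanishing to first order at `p = 0` gains one power at the top member).

HONEST DEPENDENCY (page 1, mandatory): continuum YM on T⁴ ⇐ BetaPertH ∧ nine spine estimates (0/9 proved); BetaPertH ⇐ (D1) ∧ (D4) ∧ CAP+tail;
G-an2-4 gates asym, D1 and NE2/3/4.  HONEST FRAMING (cell contract, verbatim): «discharging `BetaPertH` makes Bałaban's UV stability UNCONDITIONAL —
a real constructive-QFT result; it is NOT the continuum limit and NOT the Clay problem.»  THIS MODULE DISCHARGES NOTHING of the wall: [folklore] harmonic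
analysis ∕ calculus bookkeeping (the shift law and first difference `FP/PuncturedCoordDeriv.integrand_cexp_mul` ∕ `latticeKernel_fwdDiff` of gan24-formalise-leaf-05-g34,
imported BY NAME; the binomial product chain `FP/SliceChainN.ssN` of this lineage; Mathlib `Real.norm_exp_I_mul_ofReal_sub_one_le`).  0 `def … : Prop`; nothing cited; 0 sorry; 0 wall binders; NOT D1,
NOT BetaPertH, NOT continuum, NOT Clay.  «not in print as used here; our bookkeeping».

ABSOLUTE RULE (cell charter, verbatim): «No internally-minted statement may enter as a cited fact. Every hypothesis is either kernel-proved in this package or a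
verbatim quotation of a PUBLISHED theorem with page reference. The manuscript(s) under audit are NOT citable for their own disputed steps — they are the thing
under adjudication; programme-internal (2001/route/tribunal) claims are never citable.»

WHAT (lattice dimension `d + 1`; shift direction `μ`, slice coordinate `i`, slices `s ↦ i.insertNth (s : ℂ) Q`; `B4ContourShift.latticeKernel` currency):
* §1 [folklore] (currency of `PuncturedCoordDeriv` §5: the differenced symbol is `(e^{ip_μ} − 1)·G`) `integrableOn_integrand_cexp_mul'` ∕
  **`integrableOn_integrand_chi_mul`** (zone-integrability transfers along the shift and to the differenced symbol, for a `G` integrable at EVERY lattice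
  point), **`latticeKernel_fwdDiff₂`**: the mixed second difference `K(z+e_μ+e_ν) − K(z+e_μ) − K(z+e_ν) + K(z)` is the kernel of `(e^{ip_ν} − 1)·((e^{ip_μ} − 1)·G)`.
* §2 [folklore] THE CHARACTER CHAIN `chrN μ i : ℕ → (ℂ^{d+1} → ℂ)`: member `0 = χ_μ := e^{iP_μ} − 1`, member `b+1 = [i = μ]·I^{b+1}·e^{iP_μ}`; on every
  slice `chrN_slice_of_ne` (constant when `i ≠ μ`), `hasDerivAt_chrN` (the chain, both cases `i = μ` ∕ `i ≠ μ`), `continuous_chrN_slice`, `chrN_neg_pi_eq_pi`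
  (equal endpoint values), and the letters `norm_chrN_zero_le` (`≤ ‖p‖`), `norm_chrN_succ_le` (`≤ 1`), **`norm_chrN_le_zpow`** (`≤ R^k·‖p‖^{(1 − b : ℤ)}` for
  `0 < ‖p‖ ≤ R`, `1 ≤ R`, `b ≤ k`).
* §3 [folklore] **`norm_ssN_le_zpow`** — INTEGER-GRADED LEIBNIZ LETTERS for `SliceChainN.ssN`: `‖u a t‖ ≤ A·ρ^{(m₁ − a)}`, `‖z b t‖ ≤ B·ρ^{(m₂ − b)}`
  (`a, b ≤ n`, `0 < ρ`, integer powers) ⟹ `‖ssN u z n t‖ ≤ 2ⁿ·(A·B)·ρ^{(m₁ + m₂ − n)}`.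
* §4 [our object] THE PRODUCT FAMILY `prodN M μ i k P := Σ_{a+b=k} C(k,a)·M a P·chrN μ i b P` of a member family `M : ℕ → (ℂ^{d+1} → ℂ)` with the
  character chain; `prodN_zero` (`= (e^{iP_μ} − 1)·M 0`), `prodN_slice_eq_ssN`; rows transported from `M`: **`hasDerivAt_prodN`**, **`continuousOn_prodN`**,
  **`prodN_neg_pi_eq_pi`**, and the letter **`norm_prodN_le`**: `‖M a (p)‖ ≤ A·‖p‖^{(m − a)}` (`a ≤ k`) ⟹ `‖prodN M μ i k (p)‖ ≤ 2^k·(A·R^k)·‖p‖^{(m + 1 − k)}`.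
Consumer: PART V2 `FP/PerfectPropagatorKernelDiff` ((K2)∕(K3) of row H2-P-KER-ASM: `M` = the every-order remainder-symbol members `remSlN` at `Re W_∞`).

Provenance: binder row D1 formalisation swarm, lineage beta-d1-formalise-leaf-01, gen 9 (prover-b2b-balaban-beta-d1-formalise-leaf-01-g9-0), 2026-08-20;
road FP (owner b2b-balaban-beta-d1-p3), row H2-P-KER-ASM (holder gan24-formalise-leaf-05-g35); OFFER journal l.22410.
-/

noncomputable section

namespace Summit.QuantumFields.BalabanUV.Beta.FP.LatticeKernelShiftChain

open Complex Finset Set Filter MeasureTheory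
open scoped BigOperators Topology Real
open Literature.MathematicalPhysics.QuantumFieldTheory.Balaban1983to89
open B4Strip (ofRealVec)
open B4ContourShift (BZ phase integrand fourierBox latticeKernel ofRealVec_insertNth)
open Summit.QuantumFields.BalabanUV.Beta.FP.PuncturedCoordDeriv (integrand_cexp_mul latticeKernel_fwdDiff)
open Summit.QuantumFields.BalabanUV.Beta.FP.SliceChainN (ssN ssN_eq hasDerivAt_ssN fst_le_of_mem_antidiagonal snd_le_of_mem_antidiagonal
  sum_antidiagonal_choose)

variable {d : ℕ}

/-! ## §1 Zone-integrability along the shift; the mixed second difference -/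

/-- [folklore] zone-integrability of the phase-weighted symbol `e^{ip_μ}·G` at `x` from that of `G` at `x + e_μ` (`PuncturedCoordDeriv.integrand_cexp_mul`). -/
theorem integrableOn_integrand_cexp_mul' {G : (Fin (d + 1) → ℂ) → ℂ} (hint : ∀ x, IntegrableOn (integrand G x) (BZ (d + 1)))
    (μ : Fin (d + 1)) (x : Fin (d + 1) → ℤ) :
    IntegrableOn (integrand (fun p => cexp (I * p μ) * G p) x) (BZ (d + 1)) := by
  rw [integrand_cexp_mul]; exact hint _

/-- [folklore] **THE DIFFERENCED SYMBOL `(e^{ip_μ} − 1)·G` IS ZONE-INTEGRABLE AT EVERY LATTICE POINT** when `G` is. -/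
theorem integrableOn_integrand_chi_mul {G : (Fin (d + 1) → ℂ) → ℂ} (hint : ∀ x, IntegrableOn (integrand G x) (BZ (d + 1)))
    (μ : Fin (d + 1)) : ∀ x, IntegrableOn (integrand (fun p => (cexp (I * p μ) - 1) * G p) x) (BZ (d + 1)) := by
  intro x
  have h : integrand (fun p => (cexp (I * p μ) - 1) * G p) x = fun s => integrand (fun p => cexp (I * p μ) * G p) x s - integrand G x s := by
    funext s; unfold integrand; ring
  rw [h]
  exact (integrableOn_integrand_cexp_mul' hint μ x).sub (hint x)

/-- [folklore] **THE MIXED SECOND DIFFERENCE IS THE KERNEL OF THE TWICE-DIFFERENCED SYMBOL**: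
`K(z + e_μ + e_ν) − K(z + e_μ) − K(z + e_ν) + K(z) = latticeKernel ((e^{ip_ν} − 1)·((e^{ip_μ} − 1)·G)) z` for a zone-integrable `G`
(`PuncturedCoordDeriv.latticeKernel_fwdDiff` twice). -/
theorem latticeKernel_fwdDiff₂ {G : (Fin (d + 1) → ℂ) → ℂ} (hint : ∀ x, IntegrableOn (integrand G x) (BZ (d + 1)))
    (z : Fin (d + 1) → ℤ) (μ ν : Fin (d + 1)) :
    latticeKernel G (z + Pi.single μ 1 + Pi.single ν 1) - latticeKernel G (z + Pi.single μ 1) - latticeKernel G (z + Pi.single ν 1)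
        + latticeKernel G z
      = latticeKernel (fun p => (cexp (I * p ν) - 1) * ((cexp (I * p μ) - 1) * G p)) z := by
  have hint₁ := integrableOn_integrand_chi_mul hint μ
  have h1 := latticeKernel_fwdDiff (fun p => (cexp (I * p μ) - 1) * G p) ν z (hint₁ z) (hint₁ _)
  have h2 := latticeKernel_fwdDiff G μ (z + Pi.single ν 1) (hint _) (hint _)
  have h3 := latticeKernel_fwdDiff G μ z (hint _) (hint _)
  rw [add_right_comm]
  linear_combination -h1 - h2 + h3

/-! ## §2 The character chain in the slice coordinate `i` -/

/-- [folklore] THE CHARACTER CHAIN: member `0` is `χ_μ(P) := e^{iP_μ} − 1`, member `b + 1` is `[i = μ]·I^{b+1}·e^{iP_μ}` (the `(b+1)`-st slice derivative of `χ_μ` in the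
coordinate `i`). -/
def chrN (μ i : Fin (d + 1)) : ℕ → (Fin (d + 1) → ℂ) → ℂ
  | 0 => fun P => cexp (I * P μ) - 1
  | b + 1 => fun P => if i = μ then I ^ (b + 1) * cexp (I * P μ) else 0

/-- [folklore] off the shift direction (`i ≠ μ`) every member is CONSTANT along the slice (the inserted value is invisible to `P_μ`). -/
theorem chrN_slice_of_ne {i μ : Fin (d + 1)} (h : i ≠ μ) (b : ℕ) (s s' : ℂ) (Q : Fin d → ℂ) :
    chrN μ i b (i.insertNth s Q) = chrN μ i b (i.insertNth s' Q) := by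
  obtain ⟨j, hj⟩ := Fin.exists_succAbove_eq (Ne.symm h)
  have e : (i.insertNth s Q : Fin (d + 1) → ℂ) μ = (i.insertNth s' Q : Fin (d + 1) → ℂ) μ := by
    rw [← hj, Fin.insertNth_apply_succAbove, Fin.insertNth_apply_succAbove]
  cases b with
  | zero => simp only [chrN, e]
  | succ b => simp only [chrN, e]

/-- [folklore] the basic slice derivative `(s ↦ e^{is})′ = I·e^{it}`. -/
theorem hasDerivAt_cexp_I_mul (t : ℝ) : HasDerivAt (fun s : ℝ => cexp (I * (s : ℂ))) (I * cexp (I * (t : ℂ))) t := by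
  have h1 : HasDerivAt (fun s : ℝ => I * (s : ℂ)) (I * 1) t := (hasDerivAt_id t).ofReal_comp.const_mul I
  have h2 := h1.cexp
  rw [mul_one, mul_comm] at h2
  exact h2

/-- [folklore] **THE CHARACTER CHAIN ON EVERY SLICE** (both cases `i = μ` and `i ≠ μ`):
`(s ↦ chrN μ i b (insertNth i s Q))′(t) = chrN μ i (b+1) (insertNth i t Q)`. -/
theorem hasDerivAt_chrN (μ i : Fin (d + 1)) (b : ℕ) (Q : Fin d → ℂ) (t : ℝ) :
    HasDerivAt (fun s : ℝ => chrN μ i b (i.insertNth (s : ℂ) Q)) (chrN μ i (b + 1) (i.insertNth (t : ℂ) Q)) t := by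
  by_cases h : i = μ
  · subst h
    cases b with
    | zero =>
      simp only [chrN, Fin.insertNth_apply_same, zero_add, pow_one]
      exact (hasDerivAt_cexp_I_mul t).sub_const 1
    | succ b =>
      simp only [chrN, Fin.insertNth_apply_same, if_true]
      have h2 := (hasDerivAt_cexp_I_mul t).const_mul (I ^ (b + 1))
      have e : I ^ (b + 1) * (I * cexp (I * (t : ℂ))) = I ^ (b + 1 + 1) * cexp (I * (t : ℂ)) := by ring
      rw [e] at h2
      exact h2
  · have hc : (fun s : ℝ => chrN μ i b (i.insertNth (s : ℂ) Q)) = fun _ => chrN μ i b (i.insertNth (t : ℂ) Q) := by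
      funext s; exact chrN_slice_of_ne h b (s : ℂ) (t : ℂ) Q
    rw [hc]
    simp only [chrN, if_neg h]
    exact hasDerivAt_const t _

/-- [folklore] every member is continuous along every slice. -/
theorem continuous_chrN_slice (μ i : Fin (d + 1)) (b : ℕ) (Q : Fin d → ℂ) :
    Continuous (fun s : ℝ => chrN μ i b (i.insertNth (s : ℂ) Q)) :=
  continuous_iff_continuousAt.2 fun t => (hasDerivAt_chrN μ i b Q t).continuousAt

/-- [folklore] equal endpoint values at `∓π` (the characters are `2π`-periodic). -/
theorem chrN_neg_pi_eq_pi (μ i : Fin (d + 1)) (b : ℕ) (Q : Fin d → ℂ) :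
    chrN μ i b (i.insertNth (((-π : ℝ)) : ℂ) Q) = chrN μ i b (i.insertNth ((π : ℝ) : ℂ) Q) := by
  by_cases h : i = μ
  · subst h
    have hper : cexp (I * (((-π : ℝ)) : ℂ)) = cexp (I * ((π : ℝ) : ℂ)) := by
      rw [show I * ((π : ℝ) : ℂ) = I * (((-π : ℝ)) : ℂ) + 2 * π * I by push_cast; ring]
      exact (Complex.exp_periodic _).symm
    cases b with
    | zero => simp only [chrN, Fin.insertNth_apply_same, hper]
    | succ b => simp only [chrN, Fin.insertNth_apply_same, hper]
  · exact chrN_slice_of_ne h b _ _ Q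

/-- [folklore] THE FIRST-ORDER VANISHING OF `χ_μ`: `‖χ_μ(p)‖ ≤ |p_μ| ≤ ‖p‖` on real momenta. -/
theorem norm_chrN_zero_le (μ i : Fin (d + 1)) (p : Fin (d + 1) → ℝ) : ‖chrN μ i 0 (ofRealVec p)‖ ≤ ‖p‖ := by
  simp only [chrN]
  have e : (ofRealVec p) μ = ((p μ : ℝ) : ℂ) := rfl
  rw [e]
  exact Real.norm_exp_I_mul_ofReal_sub_one_le.trans (norm_le_pi_norm p μ)

/-- [folklore] the higher members are bounded by `1` on real momenta. -/
theorem norm_chrN_succ_le (μ i : Fin (d + 1)) (b : ℕ) (p : Fin (d + 1) → ℝ) : ‖chrN μ i (b + 1) (ofRealVec p)‖ ≤ 1 := by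
  simp only [chrN]
  split_ifs with h
  · have e : (ofRealVec p) μ = ((p μ : ℝ) : ℂ) := rfl
    rw [norm_mul, norm_pow, Complex.norm_I, one_pow, one_mul, e, mul_comm, Complex.norm_exp_ofReal_mul_I]
  · simp

/-- [folklore] **THE GRADED CHARACTER LETTERS**: for `0 < ‖p‖ ≤ R`, `1 ≤ R` and `b ≤ k`, `‖chrN μ i b (p)‖ ≤ R^k·‖p‖^{(1 − b : ℤ)}` — order of vanishing
`1` at the origin, in the integer-graded currency of `norm_ssN_le_zpow`. -/
theorem norm_chrN_le_zpow (μ i : Fin (d + 1)) {k b : ℕ} (hb : b ≤ k) {p : Fin (d + 1) → ℝ} {R : ℝ} (hp0 : 0 < ‖p‖) (hpR : ‖p‖ ≤ R)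
    (hR : 1 ≤ R) : ‖chrN μ i b (ofRealVec p)‖ ≤ R ^ k * ‖p‖ ^ ((1 : ℤ) - b) := by
  have hRk : 1 ≤ R ^ k := one_le_pow₀ hR
  cases b with
  | zero =>
    simp only [CharP.cast_eq_zero, sub_zero, zpow_one]
    calc ‖chrN μ i 0 (ofRealVec p)‖ ≤ ‖p‖ := norm_chrN_zero_le μ i p
      _ = 1 * ‖p‖ := (one_mul _).symm
      _ ≤ R ^ k * ‖p‖ := mul_le_mul_of_nonneg_right hRk hp0.le
  | succ b =>
    have hpb : 0 < ‖p‖ ^ b := pow_pos hp0 b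
    have e : ‖p‖ ^ ((1 : ℤ) - (((b + 1 : ℕ)) : ℤ)) = (‖p‖ ^ b)⁻¹ := by
      rw [show (1 : ℤ) - (((b + 1 : ℕ)) : ℤ) = -(b : ℤ) by push_cast; ring, zpow_neg, zpow_natCast]
    rw [e]
    calc ‖chrN μ i (b + 1) (ofRealVec p)‖ ≤ 1 := norm_chrN_succ_le μ i b p
      _ ≤ R ^ k * (‖p‖ ^ b)⁻¹ := by
          rw [← div_eq_mul_inv, le_div_iff₀ hpb, one_mul]
          calc ‖p‖ ^ b ≤ R ^ b := pow_le_pow_left₀ hp0.le hpR b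
            _ ≤ R ^ k := pow_le_pow_right₀ hR (by omega)

/-! ## §3 Integer-graded Leibniz letters for the scalar product chain -/

/-- [folklore] **INTEGER-GRADED LEIBNIZ LETTERS**: if `‖u a t‖ ≤ A·ρ^{(m₁ − a)}` and `‖z b t‖ ≤ B·ρ^{(m₂ − b)}` for all `a, b ≤ n` (`0 < ρ`, integer
powers), then `‖ssN u z n t‖ ≤ 2ⁿ·(A·B)·ρ^{(m₁ + m₂ − n)}` — a factor of vanishing order `m₂` lifts the top member by `m₂` powers, which the geometric
letters of `SliceChainN.norm_ssN_le` cannot see. -/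
theorem norm_ssN_le_zpow {u z : ℕ → ℝ → ℂ} {n : ℕ} {t ρ A B : ℝ} {m₁ m₂ : ℤ} (hρ : 0 < ρ)
    (bu : ∀ j ≤ n, ‖u j t‖ ≤ A * ρ ^ (m₁ - j)) (bz : ∀ j ≤ n, ‖z j t‖ ≤ B * ρ ^ (m₂ - j)) :
    ‖ssN u z n t‖ ≤ 2 ^ n * (A * B) * ρ ^ (m₁ + m₂ - n) := by
  rw [ssN_eq]
  calc ‖∑ ij ∈ antidiagonal n, (n.choose ij.1 : ℂ) * (u ij.1 t * z ij.2 t)‖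
      ≤ ∑ ij ∈ antidiagonal n, ‖(n.choose ij.1 : ℂ) * (u ij.1 t * z ij.2 t)‖ := norm_sum_le _ _
    _ ≤ ∑ ij ∈ antidiagonal n, (n.choose ij.1 : ℝ) * ((A * B) * ρ ^ (m₁ + m₂ - n)) := by
        refine Finset.sum_le_sum fun ij hij => ?_
        have ha := bu ij.1 (fst_le_of_mem_antidiagonal hij)
        have hb := bz ij.2 (snd_le_of_mem_antidiagonal hij)
        have hsum : ij.1 + ij.2 = n := Finset.HasAntidiagonal.mem_antidiagonal.mp hij
        have hA0 : 0 ≤ A * ρ ^ (m₁ - ij.1) := (norm_nonneg _).trans ha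
        rw [norm_mul, norm_mul, Complex.norm_natCast]
        refine mul_le_mul_of_nonneg_left ?_ (Nat.cast_nonneg _)
        calc ‖u ij.1 t‖ * ‖z ij.2 t‖ ≤ (A * ρ ^ (m₁ - ij.1)) * (B * ρ ^ (m₂ - ij.2)) := mul_le_mul ha hb (norm_nonneg _) hA0
          _ = (A * B) * (ρ ^ (m₁ - ij.1) * ρ ^ (m₂ - ij.2)) := by ring
          _ = (A * B) * ρ ^ (m₁ + m₂ - n) := by
              rw [← zpow_add₀ hρ.ne']
              congr 2
              rw [← hsum]; push_cast; ring
    _ = 2 ^ n * (A * B) * ρ ^ (m₁ + m₂ - n) := by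
        rw [← Finset.sum_mul, sum_antidiagonal_choose]; ring

/-! ## §4 The product family with the character chain and its rows -/

/-- [our object] THE PRODUCT FAMILY of a member family `M` with the character chain of `χ_μ` in the slice coordinate `i`:
`prodN M μ i k P := Σ_{a+b=k} C(k,a)·M a P·chrN μ i b P` (the `k`-th slice derivative of `M 0·χ_μ` when `M` is a slice chain). -/
def prodN (M : ℕ → (Fin (d + 1) → ℂ) → ℂ) (μ i : Fin (d + 1)) (k : ℕ) (P : Fin (d + 1) → ℂ) : ℂ :=
  ∑ ab ∈ antidiagonal k, (k.choose ab.1 : ℂ) * (M ab.1 P * chrN μ i ab.2 P)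

/-- [folklore] order zero is the differenced symbol `(e^{iP_μ} − 1)·M 0` (currency of `PuncturedCoordDeriv.latticeKernel_fwdDiff`). -/
theorem prodN_zero (M : ℕ → (Fin (d + 1) → ℂ) → ℂ) (μ i : Fin (d + 1)) (P : Fin (d + 1) → ℂ) :
    prodN M μ i 0 P = (cexp (I * P μ) - 1) * M 0 P := by
  simp [prodN, chrN, mul_comm]

/-- [folklore] on a slice the product family is `SliceChainN.ssN` of the two slice families. -/
theorem prodN_slice_eq_ssN (M : ℕ → (Fin (d + 1) → ℂ) → ℂ) (μ i : Fin (d + 1)) (k : ℕ) (Q : Fin d → ℂ) (t : ℝ) :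
    prodN M μ i k (i.insertNth (t : ℂ) Q)
      = ssN (fun a s => M a (i.insertNth (s : ℂ) Q)) (fun b s => chrN μ i b (i.insertNth (s : ℂ) Q)) k t := by
  rw [ssN_eq]; rfl

/-- [folklore] **THE CHAIN TRANSPORTS**: slice links of `M` up to order `k` give the slice link `prodN k → prodN (k+1)`. -/
theorem hasDerivAt_prodN {M : ℕ → (Fin (d + 1) → ℂ) → ℂ} {μ i : Fin (d + 1)} {k : ℕ} {Q : Fin d → ℂ} {t : ℝ}
    (hM : ∀ a ≤ k, HasDerivAt (fun s : ℝ => M a (i.insertNth (s : ℂ) Q)) (M (a + 1) (i.insertNth (t : ℂ) Q)) t) :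
    HasDerivAt (fun s : ℝ => prodN M μ i k (i.insertNth (s : ℂ) Q)) (prodN M μ i (k + 1) (i.insertNth (t : ℂ) Q)) t := by
  have e : (fun s : ℝ => prodN M μ i k (i.insertNth (s : ℂ) Q))
      = ssN (fun a s => M a (i.insertNth (s : ℂ) Q)) (fun b s => chrN μ i b (i.insertNth (s : ℂ) Q)) k := by
    funext s; exact prodN_slice_eq_ssN M μ i k Q s
  rw [e, prodN_slice_eq_ssN]
  exact hasDerivAt_ssN hM (fun b _ => hasDerivAt_chrN μ i b Q t)

/-- [folklore] **CONTINUITY TRANSPORTS** along a slice. -/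
theorem continuousOn_prodN {M : ℕ → (Fin (d + 1) → ℂ) → ℂ} {μ i : Fin (d + 1)} {k : ℕ} {Q : Fin d → ℂ} {S : Set ℝ}
    (hM : ∀ a ≤ k, ContinuousOn (fun s : ℝ => M a (i.insertNth (s : ℂ) Q)) S) :
    ContinuousOn (fun s : ℝ => prodN M μ i k (i.insertNth (s : ℂ) Q)) S := by
  unfold prodN
  refine continuousOn_finsetSum _ fun ab hab => continuousOn_const.mul ?_
  exact (hM ab.1 (fst_le_of_mem_antidiagonal hab)).mul (continuous_chrN_slice μ i ab.2 Q).continuousOn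

/-- [folklore] **EQUAL ENDPOINT VALUES TRANSPORT**. -/
theorem prodN_neg_pi_eq_pi {M : ℕ → (Fin (d + 1) → ℂ) → ℂ} {μ i : Fin (d + 1)} {k : ℕ} {Q : Fin d → ℂ}
    (hM : ∀ a ≤ k, M a (i.insertNth (((-π : ℝ)) : ℂ) Q) = M a (i.insertNth ((π : ℝ) : ℂ) Q)) :
    prodN M μ i k (i.insertNth (((-π : ℝ)) : ℂ) Q) = prodN M μ i k (i.insertNth ((π : ℝ) : ℂ) Q) := by
  unfold prodN
  refine Finset.sum_congr rfl fun ab hab => ?_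
  rw [hM ab.1 (fst_le_of_mem_antidiagonal hab), chrN_neg_pi_eq_pi]

/-- [our object] **THE PRODUCT LETTER**: graded member letters `‖M a (p)‖ ≤ A·‖p‖^{(m − a)}` (`a ≤ k`) on a real momentum with `0 < ‖p‖ ≤ R`, `1 ≤ R`,
give `‖prodN M μ i k (p)‖ ≤ 2^k·(A·R^k)·‖p‖^{(m + 1 − k)}` — ONE POWER GAINED from `χ_μ`. -/
theorem norm_prodN_le {M : ℕ → (Fin (d + 1) → ℂ) → ℂ} {μ i : Fin (d + 1)} {k : ℕ} {p : Fin (d + 1) → ℝ} {R A : ℝ} {m : ℤ}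
    (hp0 : 0 < ‖p‖) (hpR : ‖p‖ ≤ R) (hR : 1 ≤ R) (hM : ∀ a ≤ k, ‖M a (ofRealVec p)‖ ≤ A * ‖p‖ ^ (m - a)) :
    ‖prodN M μ i k (ofRealVec p)‖ ≤ 2 ^ k * (A * R ^ k) * ‖p‖ ^ (m + 1 - k) := by
  have e : prodN M μ i k (ofRealVec p) = ssN (fun a _ => M a (ofRealVec p)) (fun b _ => chrN μ i b (ofRealVec p)) k 0 := by
    rw [ssN_eq]; rfl
  rw [e]
  exact norm_ssN_le_zpow hp0 (fun a ha => hM a ha) (fun b hb => norm_chrN_le_zpow μ i hb hp0 hpR hR)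

end Summit.QuantumFields.BalabanUV.Beta.FP.LatticeKernelShiftChain

end
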